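import Literature.AnabelianGeometry.EtaleTheta.Discharge.Sec2KummerTwistTempered
import Literature.AnabelianGeometry.EtaleTheta.ThetaCoversKummerTwistAutomorphism
import Literature.AnabelianGeometry.EtaleTheta.Discharge.Sec2AutKHolds
import HarnessLib

/-!
# [EtTh] Cor 2.9 over the typed interface: the cusp hypotheses `hΘ ∧ hC1 ∧ hC2 ∧ HasMuL` are JOINTLY SATISFIABLE, the typed
# count `(l+1)/2` HOLDS at a kernel model for `X̲̲, C̲, C̲̲` — and the typed "preserved by arbitrary isomorphisms" STILL FAILS there

S. Mochizuki, *The étale theta function and its Frobenioid-theoretic manifestations*, Publ. RIMS **45** (2009) [MochizukiEtTh2009],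
§2, Cor. 2.9 p.43 (PDF): the labels `∈ (ℤ/lℤ)^±` of the cusps of `X̲̲, C̲, C̲̲` are in bijection with the `Aut_K`-orbits of cusps
(abc-iut-L2-t2's typed `Cor29_card`: `#orbits = (l+1)/2`), and "these bijections are preserved by arbitrary isomorphisms `γ` as in
Corollary 2.8" (typed `Cor29_preserved`: every topological automorphism of `Π^tp_C` stabilising the Prop 2.4 list and the cusp
stabiliser acts trivially on `N(Π^tp_Z) \ Π^tp_C / cuspStabC`).  abc-iut cell, block F, seat abc-iut-f-141; PROOF-ONLY (0 definitions),
over the Kummer-twist model `ThetaCoversKummerTwistTemperedDefs.lean` / `Discharge/Sec2KummerTwist{Theta,Tempered}.lean` and the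
scaling automorphism `KummerWitness.Theta` of `ThetaCoversKummerTwistAutomorphism.lean`.

WHAT IS PROVED (kernel certificates on the TYPED interface; FACT-LIST F-0600 / F-0601, GAP-LEDGER G-L2d3-2).
* `exists_model` — for every odd `l` and units `k m = 1` of `ℤ/l` with `k ≠ ±1` (so `l ≥ 5`; `exists_model_five_le` takes `k = 2`)
  there is `T : TemperedCoverData l` (finite factor `A = ((ℤ/l)³ ⋊ D_l) × ℤ/2`, `G_K = ℤ/l`, `Δ̄_Θ =` centre, `D_x = Φ⁻¹⟨c, g⟩`) with:
  (1) `K ⊇ μ_l` (`HasMuL`); (2) **`hΘ : ⁅Δ_X, Δ_X⁆ · Ker = Δ̄_Θ`**; (3) **`hC1 : cuspStabC ∩ Π^tp_X ≤ Π^tp_{X̲}`** and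
  **`hC2 : cuspStabC ⊄ Π^tp_X`** (`cuspStabC = Π^tp_{C̲} ∋ ι̲ = s r`) — so abc-iut-L2-d3's conditional Cor 2.9
  (`TemperedCoverData.cor29_card_undotted_of`, `natCard_cuspOrbits_tpPiCu{,u}`, `natCard_cuspOrbits_tpPiXuu`) is **NOT VACUOUS**
  over the interface: its four hypotheses hold together at a kernel model, and (4) its conclusion
  `#cuspOrbits = (l+1)/2` for EACH of `X̲̲, C̲, C̲̲` holds there (the first kernel INSTANCE of the typed count of F-0600 at the undotted
  members); yet (5) **`¬ T.Cor29_preserved`**: the scaling automorphism `Γ = Θ_k × id × id` ("labels `↦ k·`labels": `r ↦ r^k`,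
  `s r ↦ s r`, `c ↦ c^k`, `g ↦ g^{1/k}`) stabilises `Π^tp_{C̲}, Π^tp_{X̲}, Π^tp_X, Π^tp_Ÿ` and `cuspStabC`, but moves the orbit of the cusp
  over `r¹` to the one over `r^k` (the `{1, s r}`-double-coset invariant `cls = ±(rotation index)`: `1 ≠ ±k`).
* `not_forall_cor29_preserved_of_cusp_hypotheses` — **`hΘ ∧ hC1 ∧ hC2 ∧ HasMuL ⇏ Cor29_preserved`**, and
  `not_forall_cor29_preserved_of_card_undotted` — **the typed COUNT of Cor 2.9 (all three undotted members) does not imply the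
  typed PRESERVATION**; with abc-iut-f-142's `exists_model_cor29_preserved_not_cor29_card` (preservation ⇏ count) the two typed
  sentences of Cor 2.9 are INDEPENDENT over the interface, and with its `not_forall_cor29_preserved` (the inner-automorphism failure
  where `hC2` is false) the schema F-0601 fails in BOTH cusp regimes: a repair must constrain `Γ` (print: "`γ` as in Corollary 2.8",
  i.e. compatible with the étale theta class / the labels read off the special fibre), not only add cusp data.
HONEST LABEL: TOY (not the tempered fundamental group of a curve); statements about the TYPED interface consumed BY NAME inside abc-iut-L2;
nothing about [EtTh] Cor 2.9 itself; no side taken on [IUTchIII] Cor 3.12; typed ≠ proved.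
[cite: MochizukiEtTh2009, Cor 2.9 p.43] [cite: MochizukiEtTh2009, Def 2.5 p.39]
-/

noncomputable section

namespace Literature.AnabelianGeometry.EtaleTheta

namespace ThetaCovers

namespace KummerModel

open Multiplicative KummerWitness Literature.AnabelianGeometry.SemiGraphs
  Literature.AnabelianGeometry.EtaleTheta.SettingModel TemperedModel

variable (l : ℕ) [NeZero l]

omit [NeZero l] in
/-- Membership in `Π^tp_Ÿ = (A_X ∩ Ker two) × {0}` by coordinates. (toy bookkeeping) [cite: MochizukiEtTh2009, Def 2.5 p.40] -/
theorem mem_PiYddtp_iff (x : GtpK l) :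
    x ∈ ((TKX l ⊓ (TK.two l).ker).prod (⊥ : Subgroup (Multiplicative ℤ))) ↔
      TK.kum l x.1 ∈ kumPiX l ∧ TK.two l x.1 = 1 ∧ x.2 = 1 := by
  rw [Subgroup.mem_prod, Subgroup.mem_inf, MonoidHom.mem_ker, Subgroup.mem_bot, and_assoc]
  rfl

omit [NeZero l] in
/-- An automorphism of `Π^tp_C` lying over an automorphism `Θ` of the toy preserves the `Φ^tp`-preimage of every subgroup that `Θ`
preserves. (toy bookkeeping) [cite: MochizukiEtTh2009, Cor 2.9 p.43] -/
theorem map_comap_PhiG_eq {Γ : GtpK l ≃* GtpK l} {Θ : kumPiC l ≃* kumPiC l}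
    (hΓ : ∀ x, PhiG l (Γ.symm x) = Θ.symm (PhiG l x)) (K : Subgroup (kumPiC l)) (hK : ∀ g, Θ g ∈ K ↔ g ∈ K) :
    (K.comap (PhiG l)).map Γ.toMonoidHom = K.comap (PhiG l) := by
  ext x
  rw [Subgroup.mem_map_equiv, Subgroup.mem_comap, Subgroup.mem_comap, hΓ, ← hK (Θ.symm (PhiG l x)),
    MulEquiv.apply_symm_apply]

/-- **THE KUMMER-TWIST MODEL** (core form, for units `k m = 1` of `ℤ/l` with `k ≠ ±1`).  There is `T : ThetaCovers.TemperedCoverData l`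
with `HasMuL`, `hΘ`, `hC1`, `hC2`, the printed count `(l+1)/2` for `X̲̲, C̲, C̲̲` (by abc-iut-L2-d3's `cor29_card_undotted_of`), and
`¬ Cor29_preserved` (the scaling automorphism `Θ_k × id × id`). CONSISTENCY/INDEPENDENCE certificate on the typed interface only.
[cite: MochizukiEtTh2009, Cor 2.9 p.43] -/
theorem exists_model (hl : Odd l) (k m : ZMod l) (hkm : k * m = 1) (hk1 : k ≠ 1) (hk2 : k ≠ -1) :
    ∃ T : TemperedCoverData.{0} l,
      T.HasMuL ∧ ⁅T.DeltaX, T.DeltaX⁆ ⊔ T.barKer = T.barTheta ∧ T.cuspStabC ⊓ T.tp T.PiX ≤ T.tp T.PiXu ∧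
        ¬ T.cuspStabC ≤ T.tp T.PiX ∧
        (∀ S ∈ [T.tp T.PiXuu, T.tp T.PiCu, T.tp T.PiCuu], Nat.card (T.cuspOrbits S) = (l + 1) / 2) ∧
        ¬ T.Cor29_preserved := by
  haveI := TKX_normal l
  haveI : ((TKX l).prod (⊥ : Subgroup (Multiplicative ℤ))).Normal := Subgroup.prod_normal _ _
  let T : TemperedCoverData.{0} l :=
    { toCoverDataAx := coverDataAx l hl
      PiCuu := PiCuuK l
      isTypeLTorsThetaPm := isTypeLTorsThetaPm_PiCuuK l hl
      isOpen_PiCuu' := isOpen_PiCuuK l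
      Gtp := GtpK l
      toHat := (toHatK l).toMonoidHom
      continuous_toHat := (toHatK l).continuous
      injective_toHat := toHatK_injective l
      isProfiniteCompletion_toHat := isProfiniteCompletion_toHatK l
      PiYtp := (TKX l).prod ⊥
      PiYtp_le := by
        change (TKX l).prod ⊥ ≤ (PiXK l).comap (toHatK l).toMonoidHom
        rw [comap_toHatK_PiXK]
        exact Subgroup.prod_mono le_rfl bot_le
      PiYtp_normal := inferInstance
      isOpen_PiYtp := isOpen_discrete _
      quotZ := nonempty_quotZ l
      PiYddtp := ((TKX l ⊓ (TK.two l).ker)).prod ⊥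
      PiYddtp_le := Subgroup.prod_mono inf_le_left le_rfl
      isOpen_PiYddtp := isOpen_discrete _
      relIndex_PiYddtp := relIndex_PiYddtp l
      PiCdot := ((TK.two l).ker).prod ⊤
      index_PiCdot := index_PiCdot l
      isOpen_PiCdot := isOpen_discrete _
      PiCdot_ne := PiCdot_ne l }
  -- the tempered members of the list of `C̲` and the cusp stabiliser, concretely
  have hCu : T.tp T.PiCu = (kumHp l).comap (PhiG l) := tp_PiCu l
  have hXu : T.tp T.PiXu = (kumH l).comap (PhiG l) := tp_PiXu l
  have hX : T.tp T.PiX = (kumPiX l).comap (PhiG l) := tp_PiX l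
  have hstab : T.cuspStabC = (kumHp l).comap (PhiG l) := by
    change Subgroup.normalizer (((DxK l).comap (toHatK l).toMonoidHom : Subgroup (GtpK l)) : Set (GtpK l)) = _
    rw [tp_Dx]
    exact normalizer_tpDx l
  have hμ : T.HasMuL := fun c t ht => hasMuL_model l c ht
  have hΘ : ⁅T.DeltaX, T.DeltaX⁆ ⊔ T.barKer = T.barTheta := commutator_sup_barKer l hl
  have hC1 : T.cuspStabC ⊓ T.tp T.PiX ≤ T.tp T.PiXu := by
    rw [hstab, hX, hXu, ← Subgroup.comap_inf, kumHp_inf_kumPiX]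
  have hC2 : ¬ T.cuspStabC ≤ T.tp T.PiX := by
    rw [hstab, hX]
    intro h
    exact iota_not_mem_kumPiX l (h (show iotaG l ∈ (kumHp l).comap (PhiG l) from iota_mem_kumHp l))
  refine ⟨T, hμ, hΘ, hC1, hC2, T.cor29_card_undotted_of hΘ hC1 hC2 hμ, fun hC => ?_⟩
  -- `Γ := Θ_k × id × id`
  let ΓA : GtpK l ≃* GtpK l :=
    { toFun := fun x => ((Theta l k m hkm x.1.1, x.1.2), x.2)
      invFun := fun x => (((Theta l k m hkm).symm x.1.1, x.1.2), x.2)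
      left_inv := fun x => by simp only [MulEquiv.symm_apply_apply]; rfl
      right_inv := fun x => by simp only [MulEquiv.apply_symm_apply]; rfl
      map_mul' := fun x y => Prod.ext (Prod.ext (map_mul (Theta l k m hkm) x.1.1 y.1.1) rfl) rfl }
  let Γ : T.Gtp ≃ₜ* T.Gtp :=
    { ΓA with
      continuous_toFun := continuous_of_discreteTopology
      continuous_invFun := continuous_of_discreteTopology }
  have hΓΦ : ∀ x : GtpK l, PhiG l (Γ.toMulEquiv.symm x) = (Theta l k m hkm).symm (PhiG l x) := fun _ => rfl
  have hHp : ((kumHp l).comap (PhiG l)).map Γ.toMulEquiv.toMonoidHom = (kumHp l).comap (PhiG l) :=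
    map_comap_PhiG_eq l hΓΦ _ (mem_kumHp_theta_iff l hkm)
  -- a lift of the rotation `r¹`
  let gR : GtpK l := (TK.inK l (SemidirectProduct.inr (DihedralGroup.r 1)) 1, 1)
  have key := hC hμ (T.tp T.PiCu, [T.tp T.PiCu, T.tp T.PiXu, T.tp T.PiX, T.PiYddtp]) (by simp) Γ ?_ ?_ gR
  rotate_left
  · -- `Γ` stabilises the list of `C̲`
    intro S' hS'
    simp only [List.mem_cons, List.not_mem_nil, or_false] at hS'
    rcases hS' with rfl | rfl | rfl | rfl
    · rw [hCu]; exact hHp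
    · rw [hXu]; exact map_comap_PhiG_eq l hΓΦ _ (mem_kumH_theta_iff l hkm)
    · rw [hX]; exact map_comap_PhiG_eq l hΓΦ _ (mem_kumPiX_theta_iff l hkm)
    · change (((TKX l ⊓ (TK.two l).ker)).prod (⊥ : Subgroup (Multiplicative ℤ))).map Γ.toMulEquiv.toMonoidHom =
        ((TKX l ⊓ (TK.two l).ker)).prod ⊥
      ext x
      rw [Subgroup.mem_map_equiv, mem_PiYddtp_iff, mem_PiYddtp_iff]
      change ((Theta l k m hkm).symm (TK.kum l x.1) ∈ kumPiX l ∧ TK.two l x.1 = 1 ∧ x.2 = 1) ↔ _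
      rw [← mem_kumPiX_theta_iff l hkm ((Theta l k m hkm).symm (TK.kum l x.1)), MulEquiv.apply_symm_apply]
  · -- `Γ` stabilises the cusp stabiliser
    rw [hstab]; exact hHp
  -- the double cosets of `gR` and `Γ gR` differ: the invariant `cls` is `1` resp. `±k`
  change DoubleCoset.mk (Subgroup.normalizer ((T.tp T.PiCu : Subgroup (GtpK l)) : Set (GtpK l))) T.cuspStabC (Γ gR) =
    DoubleCoset.mk _ _ gR at key
  rw [DoubleCoset.eq] at key
  obtain ⟨x, hx, y, hy, hxy⟩ := key
  rw [hCu] at hx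
  rw [hstab] at hy
  have hx' : (PhiG l x).right = 1 ∨ (PhiG l x).right = DihedralGroup.sr 1 := by
    have hι : iotaG l ∈ (kumHp l).comap (PhiG l) := iota_mem_kumHp l
    have h := (Subgroup.mem_normalizer_iff.mp hx (iotaG l)).mp hι
    have h' : PhiG l x * iota l * (PhiG l x)⁻¹ ∈ kumHp l := by
      have h'' : PhiG l (x * iotaG l * x⁻¹) ∈ kumHp l := h
      rwa [map_mul, map_mul, map_inv] at h''
    exact mem_kumHp_of_conj_iota_mem l hl h'
  have hy' : (PhiG l y).right = 1 ∨ (PhiG l y).right = DihedralGroup.sr 1 := hy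
  have e := congrArg (fun z : GtpK l => cls l (PhiG l z).right) hxy
  simp only [map_mul, SemidirectProduct.mul_right] at e
  have eR : (PhiG l gR).right = DihedralGroup.r 1 := rfl
  have eΓ : (PhiG l (Γ gR)).right = DihedralGroup.r k := by
    change dihFun l k (DihedralGroup.r 1) = DihedralGroup.r k
    rw [dihFun_r, mul_one]
  rw [eR, eΓ, cls_r] at e
  rcases cls_mul_of_mem l hx' hy' (d := DihedralGroup.r k) with h | h
  · rw [h, cls_r] at e
    exact hk1 e.symm
  · rw [h, cls_r] at e
    exact hk2 (by linear_combination e)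

/-- **The Kummer-twist model for `l ≥ 5`** (`k = 2`, `m = (l+1)/2`): `HasMuL ∧ hΘ ∧ hC1 ∧ hC2 ∧` printed counts `∧ ¬ Cor29_preserved`.
[cite: MochizukiEtTh2009, Cor 2.9 p.43] -/
theorem exists_model_five_le (hl : Odd l) (h5 : 5 ≤ l) :
    ∃ T : TemperedCoverData.{0} l,
      T.HasMuL ∧ ⁅T.DeltaX, T.DeltaX⁆ ⊔ T.barKer = T.barTheta ∧ T.cuspStabC ⊓ T.tp T.PiX ≤ T.tp T.PiXu ∧
        ¬ T.cuspStabC ≤ T.tp T.PiX ∧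
        (∀ S ∈ [T.tp T.PiXuu, T.tp T.PiCu, T.tp T.PiCuu], Nat.card (T.cuspOrbits S) = (l + 1) / 2) ∧
        ¬ T.Cor29_preserved := by
  obtain ⟨k0, hk0⟩ := hl
  have hkm : (2 : ZMod l) * ((k0 : ZMod l) + 1) = 1 := by
    have h0 : ((2 * k0 + 1 : ℕ) : ZMod l) = 0 := by rw [← hk0]; exact ZMod.natCast_self l
    have h1 : (2 : ZMod l) * k0 + 1 = 0 := by exact_mod_cast h0
    linear_combination h1
  have hval : ∀ a : ℕ, a < l → ((a : ℕ) : ZMod l) = 0 → a = 0 := by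
    intro a ha h
    have := congrArg ZMod.val h
    rwa [ZMod.val_natCast, ZMod.val_zero, Nat.mod_eq_of_lt ha] at this
  refine exists_model l ⟨k0, hk0⟩ 2 _ hkm (fun h => ?_) (fun h => ?_)
  · have h1 : ((1 : ℕ) : ZMod l) = 0 := by push_cast; linear_combination h
    exact absurd (hval 1 (by omega) h1) one_ne_zero
  · have h3 : ((3 : ℕ) : ZMod l) = 0 := by push_cast; linear_combination h
    exact absurd (hval 3 (by omega) h3) (by norm_num)

/-- **NON-VACUITY of abc-iut-L2-d3's discharged Cor 2.9** (GAP-LEDGER G-L2d3-2): the hypotheses `HasMuL`, `hΘ : ⁅Δ_X,Δ_X⁆·Ker = Δ̄_Θ`,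
`hC1 : cuspStabC ∩ Π^tp_X ≤ Π^tp_{X̲}`, `hC2 : cuspStabC ⊄ Π^tp_X` of `TemperedCoverData.cor29_card_undotted_of` hold SIMULTANEOUSLY at a
kernel model of the typed interface (`l` odd, `l ≥ 5`). [cite: MochizukiEtTh2009, Cor 2.9 p.43] -/
theorem exists_model_cusp_hypotheses (hl : Odd l) (h5 : 5 ≤ l) :
    ∃ T : TemperedCoverData.{0} l, T.HasMuL ∧ ⁅T.DeltaX, T.DeltaX⁆ ⊔ T.barKer = T.barTheta ∧
      T.cuspStabC ⊓ T.tp T.PiX ≤ T.tp T.PiXu ∧ ¬ T.cuspStabC ≤ T.tp T.PiX := by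
  obtain ⟨T, h1, h2, h3, h4, -, -⟩ := exists_model_five_le l hl h5
  exact ⟨T, h1, h2, h3, h4⟩

/-- **FACT-LIST F-0600 (`Cor29_card`), INSTANCE FORM at the undotted members**: the typed count `#(Aut_K-orbits of cusps) = (l+1)/2` HOLDS
for `X̲̲, C̲, C̲̲` at a kernel model with `K ⊇ μ_l` (`l` odd, `l ≥ 5`) — the typed cardinality sentence is CONSISTENT with the interface
(its universal closure being refuted by abc-iut-w5-d118's `not_forall_cor29_card`). [cite: MochizukiEtTh2009, Cor 2.9 p.43] -/
theorem exists_model_card_undotted (hl : Odd l) (h5 : 5 ≤ l) :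
    ∃ T : TemperedCoverData.{0} l, T.HasMuL ∧
      ∀ S ∈ [T.tp T.PiXuu, T.tp T.PiCu, T.tp T.PiCuu], Nat.card (T.cuspOrbits S) = (l + 1) / 2 := by
  obtain ⟨T, h1, -, -, -, h5', -⟩ := exists_model_five_le l hl h5
  exact ⟨T, h1, h5'⟩

/-- **`hΘ ∧ hC1 ∧ hC2 ∧ HasMuL ⇏ Cor29_preserved`** (FACT-LIST F-0601; `l` odd, `l ≥ 5`): the typed "preserved by arbitrary isomorphisms"
fails even where ALL of abc-iut-L2-d3's cusp hypotheses hold — the typed `Γ` is under-constrained (print: "`γ` as in Corollary 2.8").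
[cite: MochizukiEtTh2009, Cor 2.9 p.43] -/
theorem not_forall_cor29_preserved_of_cusp_hypotheses (hl : Odd l) (h5 : 5 ≤ l) :
    ¬ ∀ T : TemperedCoverData.{0} l, T.HasMuL → ⁅T.DeltaX, T.DeltaX⁆ ⊔ T.barKer = T.barTheta →
      T.cuspStabC ⊓ T.tp T.PiX ≤ T.tp T.PiXu → ¬ T.cuspStabC ≤ T.tp T.PiX → T.Cor29_preserved := by
  obtain ⟨T, h1, h2, h3, h4, -, h6⟩ := exists_model_five_le l hl h5
  exact fun h => h6 (h T h1 h2 h3 h4)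

/-- **The typed COUNT of Cor 2.9 does not imply the typed PRESERVATION** (`l` odd, `l ≥ 5`): together with abc-iut-f-142's
`exists_model_cor29_preserved_not_cor29_card` the two typed sentences of [EtTh] Cor 2.9 are independent over the interface.
[cite: MochizukiEtTh2009, Cor 2.9 p.43] -/
theorem not_forall_cor29_preserved_of_card_undotted (hl : Odd l) (h5 : 5 ≤ l) :
    ¬ ∀ T : TemperedCoverData.{0} l, T.HasMuL →
      (∀ S ∈ [T.tp T.PiXuu, T.tp T.PiCu, T.tp T.PiCuu], Nat.card (T.cuspOrbits S) = (l + 1) / 2) → T.Cor29_preserved := by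
  obtain ⟨T, h1, -, -, -, h5', h6⟩ := exists_model_five_le l hl h5
  exact fun h => h6 (h T h1 h5')

/-- The same at `l = 5`, closed form. [cite: MochizukiEtTh2009, Cor 2.9 p.43] -/
theorem not_forall_cor29_preserved_of_card_undotted_five :
    ¬ ∀ T : TemperedCoverData.{0} 5, T.HasMuL →
      (∀ S ∈ [T.tp T.PiXuu, T.tp T.PiCu, T.tp T.PiCuu], Nat.card (T.cuspOrbits S) = (5 + 1) / 2) → T.Cor29_preserved :=
  not_forall_cor29_preserved_of_card_undotted 5 ⟨2, rfl⟩ le_rfl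

end KummerModel

end ThetaCovers

end Literature.AnabelianGeometry.EtaleTheta
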